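import Literature.Geometry.Symplectic.JHolomorphicSheetChart
import Mathlib.Analysis.Calculus.ContDiff.Operations
import Mathlib.Analysis.Normed.Operator.BoundedLinearMaps

/-!
# The normal frame along an immersed `J`-holomorphic curve: tangential and normal coordinates
(registered helper `helper_linearisedNormalFrame` of line `cross-cap-laurent`, crux `GromovRecognitionRelEnd`,
item stmt-SmoothPoincare4-11009; first brick of the flat proof of the child stub
`stub_normalVelocityDichotomy` of the split piece `LocalFoliationEmbeddedSpheres`, item
stmt-SmoothPoincare4-16778)

Flat model: `F` a real normed space of dimension `4`, `J : F → End(F)` smooth, `b : ℂ → F` smooth,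
immersed at `0`, `J`-holomorphic near `0` (`db_z(iα) = J(b z)(db_z α)`) with `J(b z)² = -1` near `0`.
McDuff's sheet-chart frame (McDuff 1991, Lemma 2.5; tree: `sheetChartDeriv J b ν₀ z`,
`(α, β) ↦ db_z α + Re β • ν₀ + Im β • J(b z) ν₀`) is, for a suitable normal vector `ν₀`, a real-linear
isomorphism `ℂ × ℂ → F` at `z = 0` (`exists_bijective_sheetChartDeriv`), hence on a disc about `0`.
Inverting it splits every vector `v ∈ F` into a TANGENTIAL coordinate `Q_z v ∈ ℂ` and a NORMAL
coordinate `P_z v ∈ ℂ`: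

  `v = db_z (Q_z v) + Re (P_z v) • ν₀ + Im (P_z v) • J(b z) ν₀`,

with `z ↦ P_z`, `z ↦ Q_z` smooth (inverse of a smoothly varying invertible operator), `P_z` COMPLEX
LINEAR for `J(b z)` (`P_z (J v) = i P_z v`, because the frame is `J`-complex-linear along the axis,
`sheetChartDeriv_hol`) and `P_z` killing the tangent line `db_z(ℂ)`.  This is the linear algebra behind
the normal linearised Cauchy–Riemann operator `D_u^N` of an immersed `J`-curve (Wendl 2018, §2.4–2.5;
Wendl 2010, §3): the normal coordinate of a solution of the linearised equation solves a real-linear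
Cauchy–Riemann type equation (next brick).

* `LinearisedNormal.contDiff_frame` — `z ↦ sheetChartDeriv J b ν₀ z` is `C^∞`;
* `helper_linearisedNormalFrame` — the registered package: `ν₀`, a radius `ρ > 0`, and smooth
  `P, Q : ball 0 ρ → (F →L[ℝ] ℂ)` with the decomposition, the inversion identities, complex
  linearity of `P`, `P ∘ db = 0`, and injectivity of the frame on the disc.

References: D. McDuff, *The local behaviour of holomorphic curves in almost complex 4-manifolds*,
J. Differential Geom. 34 (1991), Lemma 2.5; C. Wendl, *Holomorphic Curves in Low Dimensions* (2018),
§2.4–2.5.  No new definitions, notation or instances.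
-/

noncomputable section

open scoped ContDiff Topology
open Set Function Filter Metric Literature.Geometry.Symplectic

-- the prescribed namespace `Summit.<P>.<Sub>.…` duplicates `SmoothPoincare4` (P = Sub)
set_option linter.dupNamespace false

namespace Summit.SmoothPoincare4.SmoothPoincare4.Theorems.GromovRecognitionRelEnd.CrossCapLaurent

namespace LinearisedNormal

variable {F : Type*} [NormedAddCommGroup F] [NormedSpace ℝ F]

/-- **The sheet-chart frame varies smoothly along the curve**: `z ↦ sheetChartDeriv J b ν₀ z` is
`C^∞` for `J`, `b` of class `C^∞` (its three summands are `db_z ∘ pr₁`, a constant, and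
`(Im ∘ pr₂) • J(b z) ν₀`). [folklore] -/
theorem contDiff_frame {J : F → F →L[ℝ] F} {b : ℂ → F} (hJ : ContDiff ℝ ∞ J)
    (hb : ContDiff ℝ ∞ b) (ν₀ : F) :
    ContDiff ℝ ∞ (fun z => sheetChartDeriv J b ν₀ z) := by
  have h1 : ContDiff ℝ ∞ (fun z => (fderiv ℝ b z).comp (ContinuousLinearMap.fst ℝ ℂ ℂ)) :=
    (hb.fderiv_right (m := ∞) (by simp)).clm_comp contDiff_const
  have h2 : ContDiff ℝ ∞ (fun _ : ℂ =>
      (Complex.reCLM.comp (ContinuousLinearMap.snd ℝ ℂ ℂ)).smulRight ν₀) := contDiff_const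
  have h3 : ContDiff ℝ ∞ (fun z =>
      (Complex.imCLM.comp (ContinuousLinearMap.snd ℝ ℂ ℂ)).smulRight (J (b z) ν₀)) := by
    have hv : ContDiff ℝ ∞ (fun z => J (b z) ν₀) := (hJ.comp hb).clm_apply contDiff_const
    exact contDiff_const.smulRight hv
  have h : (fun z => sheetChartDeriv J b ν₀ z) = fun z =>
      (fderiv ℝ b z).comp (ContinuousLinearMap.fst ℝ ℂ ℂ) +
        ((Complex.reCLM.comp (ContinuousLinearMap.snd ℝ ℂ ℂ)).smulRight ν₀ +
          (Complex.imCLM.comp (ContinuousLinearMap.snd ℝ ℂ ℂ)).smulRight (J (b z) ν₀)) := rfl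
  rw [h]
  exact h1.add (h2.add h3)

/-- On the set where a smoothly varying operator is invertible, its inverse varies smoothly:
if `B z₀` is (the coercion of) a continuous linear equivalence then
`z ↦ ContinuousLinearMap.inverse (B z)` is `C^∞` at `z₀`. [folklore] -/
theorem contDiffAt_inverse_comp {E : Type*} [NormedAddCommGroup E] [NormedSpace ℝ E]
    [CompleteSpace E] {B : ℂ → E →L[ℝ] F} (hB : ContDiff ℝ ∞ B) {z₀ : ℂ} (e : E ≃L[ℝ] F)
    (he : (e : E →L[ℝ] F) = B z₀) :
    ContDiffAt ℝ ∞ (fun z => ContinuousLinearMap.inverse (B z)) z₀ := by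
  have h := contDiffAt_map_inverse (𝕜 := ℝ) (n := ∞) e
  rw [he] at h
  exact h.comp z₀ hB.contDiffAt

end LinearisedNormal

open LinearisedNormal in
/-- **Registered helper `helper_linearisedNormalFrame`: tangential/normal coordinates along an
immersed `J`-holomorphic curve.**  `F` of real dimension `4`, `J`, `b` smooth, `b` immersed at `0`,
`J`-holomorphic with `J² = -1` along `b` near `0`.  Then for some normal vector `ν₀`, radius `ρ > 0`
and smooth `P Q : ℂ → (F →L[ℝ] ℂ)` on `ball 0 ρ`: every `v ∈ F` decomposes as
`v = db_z (Q_z v) + Re (P_z v) • ν₀ + Im (P_z v) • J(b z) ν₀`; `P_z`, `Q_z` invert the frame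
`sheetChartDeriv J b ν₀ z` (`P_z (frame q) = q.2`, `Q_z (frame q) = q.1`), which is injective;
`P_z` is complex linear for `J(b z)` and kills `db_z(ℂ)`. [cite: McDuff1991LocalBehaviour, Lemma 2.5] -/
theorem helper_linearisedNormalFrame : ∀ (F : Type) [NormedAddCommGroup F] [NormedSpace ℝ F] [FiniteDimensional ℝ F], Module.finrank ℝ F = 4 → ∀ (J : F → F →L[ℝ] F) (b : ℂ → F), ContDiff ℝ ∞ J → ContDiff ℝ ∞ b → Function.Injective (fderiv ℝ b 0) → (∀ᶠ z in 𝓝 (0 : ℂ), ∀ α : ℂ, fderiv ℝ b z (Complex.I * α) = J (b z) (fderiv ℝ b z α)) → (∀ᶠ z in 𝓝 (0 : ℂ), ∀ w : F, J (b z) (J (b z) w) = -w) → ∃ (ν₀ : F) (ρ : ℝ) (P Q : ℂ → F →L[ℝ] ℂ), 0 < ρ ∧ ContDiffOn ℝ ∞ P (Metric.ball 0 ρ) ∧ ContDiffOn ℝ ∞ Q (Metric.ball 0 ρ) ∧ ∀ z ∈ Metric.ball (0 : ℂ) ρ, (∀ α : ℂ, fderiv ℝ b z (Complex.I * α) = J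 (b z) (fderiv ℝ b z α)) ∧ (∀ w : F, J (b z) (J (b z) w) = -w) ∧ Function.Injective (Literature.Geometry.Symplectic.sheetChartDeriv J b ν₀ z) ∧ (∀ v : F, v = fderiv ℝ b z (Q z v) + ((P z v).re • ν₀ + (P z v).im • J (b z) ν₀)) ∧ (∀ q : ℂ × ℂ, P z (Literature.Geometry.Symplectic.sheetChartDeriv J b ν₀ z q) = q.2) ∧ (∀ q : ℂ × ℂ, Q z (Literature.Geometry.Symplectic.sheetChartDeriv J b ν₀ z q) = q.1) ∧ (∀ v : F, P z (J (b z) v) = Complex.I * P z v) ∧ (∀ w : ℂ, P z (fderiv ℝ b z w) = 0) := by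
  intro F _ _ _ h4 J b hJ hb hinj hbJ hJ2
  -- the data at `0`
  have hbJ0 : ∀ α : ℂ, fderiv ℝ b 0 (Complex.I * α) = J (b 0) (fderiv ℝ b 0 α) := hbJ.self_of_nhds
  have hJ20 : ∀ w : F, J (b 0) (J (b 0) w) = -w := hJ2.self_of_nhds
  obtain ⟨ν₀, hbij⟩ := exists_bijective_sheetChartDeriv h4 hinj hbJ0 hJ20
  -- the frame as a smooth operator-valued map
  set B : ℂ → (ℂ × ℂ →L[ℝ] F) := fun z => sheetChartDeriv J b ν₀ z with hB_def
  have hBs : ContDiff ℝ ∞ B := contDiff_frame hJ hb ν₀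
  -- the set where the frame is invertible is an open neighbourhood of `0`
  haveI : CompleteSpace (ℂ × ℂ) := inferInstance
  set U : Set ℂ := B ⁻¹' range ((↑) : ((ℂ × ℂ) ≃L[ℝ] F) → (ℂ × ℂ) →L[ℝ] F) with hU_def
  have hUo : IsOpen U :=
    (ContinuousLinearEquiv.isOpen (𝕜 := ℝ) (E := ℂ × ℂ) (F := F)).preimage hBs.continuous
  have h0U : (0 : ℂ) ∈ U := by
    refine ⟨(LinearEquiv.ofBijective ((B 0 : ℂ × ℂ →L[ℝ] F) : ℂ × ℂ →ₗ[ℝ] F)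
      hbij).toContinuousLinearEquiv, ?_⟩
    exact ContinuousLinearMap.ext fun _ => rfl
  -- a disc inside `U` on which `b` is `J`-holomorphic with `J² = -1`
  obtain ⟨ρ, hρ, hρU⟩ : ∃ ρ : ℝ, 0 < ρ ∧ ∀ z ∈ ball (0 : ℂ) ρ, z ∈ U ∧
      (∀ α : ℂ, fderiv ℝ b z (Complex.I * α) = J (b z) (fderiv ℝ b z α)) ∧
      (∀ w : F, J (b z) (J (b z) w) = -w) := by
    have hev : ∀ᶠ z in 𝓝 (0 : ℂ), z ∈ U ∧
        (∀ α : ℂ, fderiv ℝ b z (Complex.I * α) = J (b z) (fderiv ℝ b z α)) ∧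
        (∀ w : F, J (b z) (J (b z) w) = -w) :=
      (hUo.eventually_mem h0U).and (hbJ.and hJ2)
    obtain ⟨ρ, hρ, h⟩ := Metric.eventually_nhds_iff_ball.1 hev
    exact ⟨ρ, hρ, h⟩
  -- the coordinates
  set P : ℂ → F →L[ℝ] ℂ := fun z =>
    (ContinuousLinearMap.snd ℝ ℂ ℂ).comp (ContinuousLinearMap.inverse (B z)) with hP_def
  set Q : ℂ → F →L[ℝ] ℂ := fun z =>
    (ContinuousLinearMap.fst ℝ ℂ ℂ).comp (ContinuousLinearMap.inverse (B z)) with hQ_def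
  -- on `U` the frame is an equivalence
  have hequiv : ∀ z ∈ U, ∃ e : (ℂ × ℂ) ≃L[ℝ] F, (e : ℂ × ℂ →L[ℝ] F) = B z := fun z hz => hz
  have hinvs : ∀ z ∈ U, ContDiffAt ℝ ∞ (fun z => ContinuousLinearMap.inverse (B z)) z := by
    intro z hz
    obtain ⟨e, he⟩ := hequiv z hz
    exact contDiffAt_inverse_comp hBs e he
  have hleft : ∀ z ∈ U, ∀ q : ℂ × ℂ, ContinuousLinearMap.inverse (B z) (B z q) = q := by
    intro z hz q
    obtain ⟨e, he⟩ := hequiv z hz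
    rw [← he, ContinuousLinearMap.inverse_equiv]
    exact e.symm_apply_apply q
  have hright : ∀ z ∈ U, ∀ v : F, B z (ContinuousLinearMap.inverse (B z) v) = v := by
    intro z hz v
    obtain ⟨e, he⟩ := hequiv z hz
    rw [← he, ContinuousLinearMap.inverse_equiv]
    exact e.apply_symm_apply v
  have hinjB : ∀ z ∈ U, Injective (B z) := by
    intro z hz
    obtain ⟨e, he⟩ := hequiv z hz
    rw [← he]
    exact e.injective
  refine ⟨ν₀, ρ, P, Q, hρ, ?_, ?_, fun z hz => ?_⟩
  · intro z hz
    exact (contDiffAt_const.clm_comp (hinvs z (hρU z hz).1)).contDiffWithinAt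
  · intro z hz
    exact (contDiffAt_const.clm_comp (hinvs z (hρU z hz).1)).contDiffWithinAt
  obtain ⟨hzU, hbJz, hJ2z⟩ := hρU z hz
  refine ⟨hbJz, hJ2z, hinjB z hzU, fun v => ?_, fun q => ?_, fun q => ?_, fun v => ?_, fun w => ?_⟩
  · -- decomposition: `v = B z (B z)⁻¹ v` read through `sheetChartDeriv_apply`
    have h := hright z hzU v
    rw [hB_def, sheetChartDeriv_apply] at h
    show v = fderiv ℝ b z ((ContinuousLinearMap.fst ℝ ℂ ℂ) (ContinuousLinearMap.inverse (B z) v)) +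
      ((((ContinuousLinearMap.snd ℝ ℂ ℂ) (ContinuousLinearMap.inverse (B z) v)).re • ν₀ +
        ((ContinuousLinearMap.snd ℝ ℂ ℂ) (ContinuousLinearMap.inverse (B z) v)).im • J (b z) ν₀))
    rw [← add_assoc]
    exact h.symm
  · show (ContinuousLinearMap.snd ℝ ℂ ℂ) (ContinuousLinearMap.inverse (B z) (B z q)) = q.2
    rw [hleft z hzU q]
    rfl
  · show (ContinuousLinearMap.fst ℝ ℂ ℂ) (ContinuousLinearMap.inverse (B z) (B z q)) = q.1
    rw [hleft z hzU q]
    rfl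
  · -- complex linearity: write `v = B z q`, then `J (B z q) = B z (i q.1, i q.2)`
    set q : ℂ × ℂ := ContinuousLinearMap.inverse (B z) v with hq
    have hv : v = B z q := (hright z hzU v).symm
    have hhol : J (b z) (B z q) = B z (Complex.I * q.1, Complex.I * q.2) := by
      rw [hB_def]
      have := sheetChartDeriv_hol (ν₀ := ν₀) hbJz hJ2z q.1 q.2
      simpa only [Prod.mk.eta] using this
    show (ContinuousLinearMap.snd ℝ ℂ ℂ) (ContinuousLinearMap.inverse (B z) (J (b z) v)) =
      Complex.I * (ContinuousLinearMap.snd ℝ ℂ ℂ) (ContinuousLinearMap.inverse (B z) v)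
    rw [hv, hhol, hleft z hzU, hleft z hzU]
    rfl
  · -- `db_z w = B z (w, 0)`
    have hw : fderiv ℝ b z w = B z (w, 0) := by
      rw [hB_def, sheetChartDeriv_apply]
      simp
    show (ContinuousLinearMap.snd ℝ ℂ ℂ) (ContinuousLinearMap.inverse (B z) (fderiv ℝ b z w)) = 0
    rw [hw, hleft z hzU]
    rfl

end Summit.SmoothPoincare4.SmoothPoincare4.Theorems.GromovRecognitionRelEnd.CrossCapLaurent

end
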